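import Literature.Geometry.Kaehler.ComplexTorusRationalGradedPoincarePairing
import Literature.Geometry.Kaehler.ComplexTorusKleimanFormsHodgeRiemann
import HarnessLib

/-!
# André's and Kleiman's forms OVER `ℚ`: `K_H^ℚ = B_ℚ(·, *_H| ·)`, `K_∗^ℚ = B_ℚ(·, ∗| ·)` on `H•(X; ℚ)` — `ℚ`-bilinear forms with complexifications `K_H`, `K_∗`;
# non-degenerate, `(−1)ᵏ`-symmetric, `L_η| ↔ Λ_η|` mutually `K_H^ℚ`-adjoint; and on the Hodge classes of a polarized torus
# `sign_X(e)(−1)^g K^ℚ(x, x) > 0` IN `ℚ` — POSITIVE-DEFINITE RATIONAL QUADRATIC FORMS ON `Hdgᵖ(X)`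

Layer `Literature/Geometry/Kaehler`, namespace `Literature.Geometry.Kaehler.ComplexTorus`; lane `lit-hodgefound` (Track 2 foundations library),
prover seat `lit-hodgefound-p35` (generation 51, row g51-#7; sequel of rows g51-#4 `ComplexTorusRationalGradedPoincarePairing` — `B_ℚ = poincarePairingGRat Φ e`,
`rationalEndRestrict : rationalEnd Φ →ₐ[ℚ] End H•(X;ℚ)`, `K_L^ℚ` non-degenerate —, g51-#5 `ComplexTorusKleimanFormsAndre` and g51-#6 `ComplexTorusKleimanFormsHodgeRiemann`
(`K_H`, `K_∗` over `ℂ`, André's positivity, the Hodge–Riemann relations, positive rational values on `Hdgᵖ`)). THEOREMS ONLY (no definition, no named fact, no instance,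
no notation; D-0026 net debt `0`).

THE POINT. André's Prop. 1.2 is a statement about "sous-algèbres `ℚ[L, *_L]`, `ℚ[L, *_H]`, `ℚ[L, ᶜΛ]` de `End H*(X)`" and the transposition for `(x, y) ↦ ∫ x ∪ *y` — all
OVER `ℚ`; the Standard-Conjecture-type use of `*_H` ("la forme `x ↦ ⟨x, *_H x⟩` est définie positive sur les cycles") needs the form as a RATIONAL quadratic form on the
`ℚ`-space of algebraic / Hodge classes. Rows g51-#5/#6 proved everything over `ℂ` (with "`∈ ℚ`" as existence statements). THIS FILE puts André's `K_H` and Kleiman's `K_∗`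
on the `ℚ`-vector space `H•(X; ℚ) = rationalFormsG Φ` as honest `LinearMap.BilinForm ℚ`'s — `(poincarePairingGRat Φ e).compl₂ (rationalEndRestrict Φ ⟨*_H, _⟩)` (`*_H`, `∗`
normalised by `d = g` are rational operators: row g49-#3 `andreHodgeInvolution_apply_mem_rationalFormsG`, row g50-#6 `IsNSForm.hodgeInvolution_mem_rationalEnd`) — and
transfers: the complexification identities, NON-DEGENERACY over `ℚ`, `(−1)ᵏ`-symmetry, the generator-level transposition `L_η| ↔ Λ_η|` (`*_H`), `H|` and `*_H|` self-adjoint,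
and, for a polarized torus, THE RATIONAL INEQUALITY `0 < sign_X(e)(−1)^g K^ℚ(x, x)` for every non-zero Hodge class `x ∈ Hdgᵖ(X)` (both `K_H^ℚ` and `K_∗^ℚ`), with the
anisotropy `K^ℚ(x, x) = 0 ↔ x = 0` there.

## What is proved (`η ∈ NS(X)` non-degenerate — `hNS : IsNSForm Φ η`, `hη` —, `e : Fin N ≃ ι`; `s| = rationalEndRestrict Φ ⟨s, _⟩`)

* §1 `IsNSForm.andreHodgeInvolution_mem_rationalEnd` (`*_H ∈ 𝔤𝔩(H•(X; ℚ))`, normalisation `g`), **`IsNSForm.coe_poincarePairingGRat_compl₂_andreHodgeInvolution`**,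
  **`IsNSForm.coe_poincarePairingGRat_compl₂_hodgeInvolution`** (`(K^ℚ(w, w') : ℂ) = K(w, w')`).
* §2 **`isAdjointPair_poincarePairingGRat_compl₂_iff`** (for rational `s, T, T'`: `T|, T'|` are `B_ℚ(·, s|·)`-adjoint IFF `T, T'` are `B_e(·, s ·)`-adjoint — density of `H•(X;ℚ)`),
  **`IsNSForm.isAdjointPair_poincarePairingGRat_compl₂_andreHodgeInvolution_lefschetzG_lefschetzDualG`** / `…_lefschetzDualG_lefschetzG` (`L_η|` and `Λ_η|` are mutually
  `K_H^ℚ`-adjoint IN `End H•(X; ℚ)`), `IsNSForm.isSelfAdjoint_poincarePairingGRat_compl₂_andreHodgeInvolution_countingG`, `…_andreHodgeInvolution_andreHodgeInvolution` (`H|`, `*_H|`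
  are `K_H^ℚ`-symmetric), `IsNSForm.isAdjointPair_poincarePairingGRat_compl₂_lefschetzInvolution_lefschetzG_conj` (`K_L^ℚ`: `L_η| ↦ (*_L L_η *_L)|`, André's `ᶜL`).
* §3 `IsNSForm.poincarePairingGRat_compl₂_andreHodgeInvolution_apply_of_comm` / `…_hodgeInvolution_apply_of_comm` (`K^ℚ(w, x) = (−1)ᵏ K^ℚ(x, w)` for `x ∈ Hᵏ(X; ℚ)`),
  **`IsNSForm.poincarePairingGRat_compl₂_andreHodgeInvolution_nondegenerate`**, **`IsNSForm.poincarePairingGRat_compl₂_hodgeInvolution_nondegenerate`**.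
* §4 ON THE HODGE CLASSES OF A POLARIZED TORUS (`hR : IsRiemannForm Φ η`, `e : Fin (2g) ≃ ι`): **`IsRiemannForm.orientationSign_mul_poincarePairingGRat_compl₂_andreHodgeInvolution_self_pos`**
  (`0 < sign_X(e)(−1)^g K_H^ℚ(x, x)` in `ℚ` for `0 ≠ x ∈ Hdgᵖ(X)`), **`IsRiemannForm.orientationSign_mul_poincarePairingGRat_compl₂_hodgeInvolution_self_pos`** (the same for Kleiman's
  `K_∗^ℚ`), `IsRiemannForm.poincarePairingGRat_compl₂_andreHodgeInvolution_self_eq_zero_iff` / `…_hodgeInvolution_self_eq_zero_iff` (anisotropy on `Hdgᵖ(X)` over `ℚ`).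

## Sources, VERBATIM

* Y. André, *Pour une théorie inconditionnelle des motifs*, Publ. Math. IHÉS **83** (1996) [Andre1996Motifs] (held `paper:doi-10-1007-bf02698643`), Prop. 1.2 (p. 11 = p0008 L62–L66):
  "On a un isomorphisme canonique d'algèbres […] des sous-algèbres `ℚ[L, *_L]`, `ℚ[L, *_H]`, `ℚ[L, ᶜΛ]` de `End H*(X)` […] la transposition relative à la forme bilinéaire
  `(x, y) ↦ ∫ x ∪ *y` correspond à la transposition des matrices, pour `* = *_L` ou `*_H`"; §1.1 Remarque (p. 11 = p0008 L11–L14): "cet opérateur star et `*_H` ont les mêmes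
  propriétés de positivité sur les cycles réels de type `(p,p)`".
* E. Looijenga, V. A. Lunts, *A Lie algebra attached to a projective variety*, Invent. Math. **129** (1997) [LooijengaLunts1997], §1 (1.7) p. 6 (`𝔤(𝔞, M)` is defined over `ℚ`).
* S. L. Kleiman, *Algebraic cycles and the Weil conjectures* (1968) [Kleiman1968AlgebraicCycles], §1.4 (1.4.2–1.4.4: `⋆`, `pʲ`, `Λ ∈ ℚ[L, …]`) and §3 (Hodge index / positivity of `⟨x, ⋆x⟩`).
* H. Lange, *Abelian Varieties over the Complex Numbers* (2023) [Lange2023AbelianVarietiesComplex], §6.2.4 (p. 310: Poincaré duality over `ℤ`), §7.2.2 (Hodge classes).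
* C. Voisin, *Hodge Theory and Complex Algebraic Geometry I* (CUP 2002) [VoisinHodgeI2002], §6.3.2 Thm. 6.32, §7.1.2.
-/

namespace Literature.Geometry.Kaehler

namespace ComplexTorus

open Module Function Finset
open Literature.LinearAlgebra.Alternating Literature.Algebra.Lie Literature.Analysis.Complex

set_option maxSynthPendingDepth 3

universe uE

variable {ι : Type*} [Fintype ι] [DecidableEq ι] {E : Type uE} [NormedAddCommGroup E] [NormedSpace ℂ E] [FiniteDimensional ℂ E]
  [Nontrivial E] (Φ : (ι → ℝ) ≃L[ℝ] E) {η : E [⋀^Fin 2]→L[ℝ] ℝ} {N : ℕ}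

/-! ## §1 `*_H`, `∗` as rational operators; the `ℚ`-forms and their complexifications -/

section RationalForms

/-- **`*_H ∈ 𝔤𝔩(H•(X; ℚ))`** for `η ∈ NS(X)` non-degenerate (normalisation `d = g`; row g49-#3 `andreHodgeInvolution_apply_mem_rationalFormsG`).
[cite: LooijengaLunts1997, §1 (1.7) p. 6] [cite: Andre1996Motifs, §1.1 (p. 10) and Prop. 1.2 (p. 11, "`ℚ[L, *_H]` […] de `End H*(X)`")] -/
theorem IsNSForm.andreHodgeInvolution_mem_rationalEnd (hNS : IsNSForm Φ η) (hη : ∀ v : E, v ≠ 0 → ∃ w : E, η ![v, w] ≠ 0) :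
    (hasLefschetzProperty_lefschetzG hη).andreHodgeInvolution isZGrading_countingG (finrank ℂ E) ∈ rationalEnd Φ :=
  fun _ hw ↦ andreHodgeInvolution_apply_mem_rationalFormsG Φ (mem_neronSeveriQ_of_isNSForm Φ hNS) hη rfl hw

/-- **`(K_H^ℚ(w, w') : ℂ) = K_H(w, w')`**: André's `ℚ`-form `B_ℚ(·, *_H| ·)` on `H•(X; ℚ)` complexifies to `K_H = B_e(·, *_H ·)`.
[cite: Andre1996Motifs, Prop. 1.2 (p. 11)] [cite: LooijengaLunts1997, §1 (1.7) p. 6] -/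
theorem IsNSForm.coe_poincarePairingGRat_compl₂_andreHodgeInvolution (hNS : IsNSForm Φ η) (hη : ∀ v : E, v ≠ 0 → ∃ w : E, η ![v, w] ≠ 0) (e : Fin N ≃ ι)
    (w w' : rationalFormsG Φ) :
    (((poincarePairingGRat Φ e).compl₂ (rationalEndRestrict Φ
        ⟨(hasLefschetzProperty_lefschetzG hη).andreHodgeInvolution isZGrading_countingG (finrank ℂ E), hNS.andreHodgeInvolution_mem_rationalEnd Φ hη⟩) w w' : ℚ) : ℂ) =
      (poincarePairingG Φ e).compl₂ ((hasLefschetzProperty_lefschetzG hη).andreHodgeInvolution isZGrading_countingG (finrank ℂ E)) (w : GForm E ℂ) (w' : GForm E ℂ) := by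
  rw [LinearMap.compl₂_apply, LinearMap.compl₂_apply, coe_poincarePairingGRat, coe_rationalEndRestrict_apply]

/-- **`(K_∗^ℚ(w, w') : ℂ) = K_∗(w, w')`**: Kleiman's `ℚ`-form `B_ℚ(·, ∗| ·)` (normalisation `d = g`, row g50-#6 `IsNSForm.hodgeInvolution_mem_rationalEnd`) complexifies to `K_∗`.
[cite: Kleiman1968AlgebraicCycles, §1.4 (1.4.2, 1.4.4)] [cite: Andre1996Motifs, Prop. 1.2 (p. 11)] -/
theorem IsNSForm.coe_poincarePairingGRat_compl₂_hodgeInvolution (hNS : IsNSForm Φ η) (hη : ∀ v : E, v ≠ 0 → ∃ w : E, η ![v, w] ≠ 0) (e : Fin N ≃ ι)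
    (w w' : rationalFormsG Φ) :
    (((poincarePairingGRat Φ e).compl₂ (rationalEndRestrict Φ
        ⟨(hasLefschetzProperty_lefschetzG hη).hodgeInvolution isZGrading_countingG (finrank ℂ E), hNS.hodgeInvolution_mem_rationalEnd Φ hη⟩) w w' : ℚ) : ℂ) =
      (poincarePairingG Φ e).compl₂ ((hasLefschetzProperty_lefschetzG hη).hodgeInvolution isZGrading_countingG (finrank ℂ E)) (w : GForm E ℂ) (w' : GForm E ℂ) := by
  rw [LinearMap.compl₂_apply, LinearMap.compl₂_apply, coe_poincarePairingGRat, coe_rationalEndRestrict_apply]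

end RationalForms

/-! ## §2 Transposition over `ℚ` -/

section Transposition

omit [Nontrivial E] in
/-- **TRANSFER OF ADJOINTNESS FOR THE TWISTED FORMS: for rational operators `s, T, T'`, the restrictions `T|, T'|` are adjoint for `B_ℚ(·, s| ·)` on `H•(X; ℚ)` IFF `T, T'` are
adjoint for `B_e(·, s ·)` on `H•(X; ℂ)`** (⇐ by restriction; ⇒ by density of `H•(X; ℚ)` in `H•(X; ℂ)`, both sides being `ℂ`-bilinear). [cite: LooijengaLunts1997, §1 (1.7) p. 6]
[cite: Andre1996Motifs, Prop. 1.2 (p. 11)] -/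
theorem isAdjointPair_poincarePairingGRat_compl₂_iff (e : Fin N ≃ ι) {s T T' : rationalEnd Φ} :
    LinearMap.IsAdjointPair ((poincarePairingGRat Φ e).compl₂ (rationalEndRestrict Φ s)) ((poincarePairingGRat Φ e).compl₂ (rationalEndRestrict Φ s))
        (rationalEndRestrict Φ T) (rationalEndRestrict Φ T') ↔
      LinearMap.IsAdjointPair ((poincarePairingG Φ e).compl₂ (s : Module.End ℂ (GForm E ℂ))) ((poincarePairingG Φ e).compl₂ (s : Module.End ℂ (GForm E ℂ)))
        (T : Module.End ℂ (GForm E ℂ)) (T' : Module.End ℂ (GForm E ℂ)) := by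
  refine ⟨fun h ↦ ?_, fun h w w' ↦ ?_⟩
  · rw [LinearMap.isAdjointPair_iff_comp_eq_compl₂]
    refine LinearMap.ext_on (span_complex_rationalFormsG_eq_top Φ) fun w hw ↦ ?_
    refine LinearMap.ext_on (span_complex_rationalFormsG_eq_top Φ) fun w' hw' ↦ ?_
    rw [LinearMap.comp_apply, LinearMap.compl₂_apply, LinearMap.compl₂_apply, LinearMap.compl₂_apply]
    have h1 := congrArg (fun q : ℚ ↦ (q : ℂ)) (h ⟨w, hw⟩ ⟨w', hw'⟩)
    simpa only [LinearMap.compl₂_apply, coe_poincarePairingGRat, coe_rationalEndRestrict_apply] using h1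
  · apply Rat.cast_injective (α := ℂ)
    rw [LinearMap.compl₂_apply, LinearMap.compl₂_apply, coe_poincarePairingGRat, coe_poincarePairingGRat, coe_rationalEndRestrict_apply, coe_rationalEndRestrict_apply,
      coe_rationalEndRestrict_apply, coe_rationalEndRestrict_apply]
    exact h w w'

/-- **"CES GÉNÉRATEURS S'ÉCHANGENT PAR LA TRANSPOSITION" IN `End H•(X; ℚ)`: `L_η|` and `Λ_η|` are mutually `K_H^ℚ`-adjoint** — `K_H^ℚ(L_η x, y) = K_H^ℚ(x, Λ_η y)` on `H•(X; ℚ)`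
(row g51-#5 over `ℂ`, transferred). [cite: Andre1996Motifs, Prop. 1.2 (pp. 11–12, "pour `* = *_L` ou `*_H`")] -/
theorem IsNSForm.isAdjointPair_poincarePairingGRat_compl₂_andreHodgeInvolution_lefschetzG_lefschetzDualG (hNS : IsNSForm Φ η)
    (hη : ∀ v : E, v ≠ 0 → ∃ w : E, η ![v, w] ≠ 0) (e : Fin N ≃ ι) :
    LinearMap.IsAdjointPair
      ((poincarePairingGRat Φ e).compl₂ (rationalEndRestrict Φ
        ⟨(hasLefschetzProperty_lefschetzG hη).andreHodgeInvolution isZGrading_countingG (finrank ℂ E), hNS.andreHodgeInvolution_mem_rationalEnd Φ hη⟩))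
      ((poincarePairingGRat Φ e).compl₂ (rationalEndRestrict Φ
        ⟨(hasLefschetzProperty_lefschetzG hη).andreHodgeInvolution isZGrading_countingG (finrank ℂ E), hNS.andreHodgeInvolution_mem_rationalEnd Φ hη⟩))
      (rationalEndRestrict Φ ⟨lefschetzG η, lefschetzG_mem_rationalEnd Φ (hNS.ofRealForm_mem_rationalForms Φ)⟩)
      (rationalEndRestrict Φ ⟨lefschetzDualG η, lefschetzDualG_mem_rationalEnd Φ (mem_neronSeveriQ_of_isNSForm Φ hNS) hη⟩) :=
  (isAdjointPair_poincarePairingGRat_compl₂_iff Φ e).2 (isAdjointPair_compl₂_andreHodgeInvolution_lefschetzG_lefschetzDualG Φ hη e (finrank ℂ E))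

/-- **… and `K_H^ℚ(Λ_η x, y) = K_H^ℚ(x, L_η y)` on `H•(X; ℚ)`.** [cite: Andre1996Motifs, Prop. 1.2 (pp. 11–12)] -/
theorem IsNSForm.isAdjointPair_poincarePairingGRat_compl₂_andreHodgeInvolution_lefschetzDualG_lefschetzG (hNS : IsNSForm Φ η)
    (hη : ∀ v : E, v ≠ 0 → ∃ w : E, η ![v, w] ≠ 0) (e : Fin N ≃ ι) :
    LinearMap.IsAdjointPair
      ((poincarePairingGRat Φ e).compl₂ (rationalEndRestrict Φ
        ⟨(hasLefschetzProperty_lefschetzG hη).andreHodgeInvolution isZGrading_countingG (finrank ℂ E), hNS.andreHodgeInvolution_mem_rationalEnd Φ hη⟩))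
      ((poincarePairingGRat Φ e).compl₂ (rationalEndRestrict Φ
        ⟨(hasLefschetzProperty_lefschetzG hη).andreHodgeInvolution isZGrading_countingG (finrank ℂ E), hNS.andreHodgeInvolution_mem_rationalEnd Φ hη⟩))
      (rationalEndRestrict Φ ⟨lefschetzDualG η, lefschetzDualG_mem_rationalEnd Φ (mem_neronSeveriQ_of_isNSForm Φ hNS) hη⟩)
      (rationalEndRestrict Φ ⟨lefschetzG η, lefschetzG_mem_rationalEnd Φ (hNS.ofRealForm_mem_rationalForms Φ)⟩) :=
  (isAdjointPair_poincarePairingGRat_compl₂_iff Φ e).2 (isAdjointPair_compl₂_andreHodgeInvolution_lefschetzDualG_lefschetzG Φ hη e (finrank ℂ E))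

/-- **`H|` is `K_H^ℚ`-symmetric on `H•(X; ℚ)`.** [cite: Andre1996Motifs, §1.2 (p. 11)] [cite: LooijengaLunts1997, §1 (1.7) p. 6] -/
theorem IsNSForm.isSelfAdjoint_poincarePairingGRat_compl₂_andreHodgeInvolution_countingG (hNS : IsNSForm Φ η) (hη : ∀ v : E, v ≠ 0 → ∃ w : E, η ![v, w] ≠ 0)
    (e : Fin N ≃ ι) :
    ((poincarePairingGRat Φ e).compl₂ (rationalEndRestrict Φ
        ⟨(hasLefschetzProperty_lefschetzG hη).andreHodgeInvolution isZGrading_countingG (finrank ℂ E), hNS.andreHodgeInvolution_mem_rationalEnd Φ hη⟩)).IsSelfAdjoint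
      (rationalEndRestrict Φ ⟨countingG E, countingG_mem_rationalEnd Φ⟩) :=
  (isAdjointPair_poincarePairingGRat_compl₂_iff Φ e).2 (isSelfAdjoint_compl₂_andreHodgeInvolution_countingG Φ hη e (finrank ℂ E))

/-- **`*_H|` is `K_H^ℚ`-symmetric on `H•(X; ℚ)`** (`K_H(*_H w, w') = B(w, w') = K_H(w, *_H w')`). [cite: Andre1996Motifs, §1.1 Remarque (p. 11)] -/
theorem IsNSForm.isSelfAdjoint_poincarePairingGRat_compl₂_andreHodgeInvolution_andreHodgeInvolution (hNS : IsNSForm Φ η)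
    (hη : ∀ v : E, v ≠ 0 → ∃ w : E, η ![v, w] ≠ 0) (e : Fin N ≃ ι) :
    ((poincarePairingGRat Φ e).compl₂ (rationalEndRestrict Φ
        ⟨(hasLefschetzProperty_lefschetzG hη).andreHodgeInvolution isZGrading_countingG (finrank ℂ E), hNS.andreHodgeInvolution_mem_rationalEnd Φ hη⟩)).IsSelfAdjoint
      (rationalEndRestrict Φ
        ⟨(hasLefschetzProperty_lefschetzG hη).andreHodgeInvolution isZGrading_countingG (finrank ℂ E), hNS.andreHodgeInvolution_mem_rationalEnd Φ hη⟩) :=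
  (isAdjointPair_poincarePairingGRat_compl₂_iff Φ e).2 (isSelfAdjoint_compl₂_andreHodgeInvolution_andreHodgeInvolution Φ hη e (finrank ℂ E))

/-- **For `K_L^ℚ`: `L_η| ↦ (*_L L_η *_L)|`** — the `K_L^ℚ`-transpose of `L_η|` on `H•(X; ℚ)` is the restriction of André's `ᶜL = *_L L_η *_L` (row g51-#2 over `ℂ`, transferred).
[cite: Andre1996Motifs, Prop. 1.2 (pp. 11–12)] -/
theorem IsNSForm.isAdjointPair_poincarePairingGRat_compl₂_lefschetzInvolution_lefschetzG_conj (hNS : IsNSForm Φ η) (hη : ∀ v : E, v ≠ 0 → ∃ w : E, η ![v, w] ≠ 0)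
    (e : Fin N ≃ ι) :
    LinearMap.IsAdjointPair
      ((poincarePairingGRat Φ e).compl₂ (rationalEndRestrict Φ
        ⟨(hasLefschetzProperty_lefschetzG hη).lefschetzInvolution isZGrading_countingG, hNS.lefschetzInvolution_mem_rationalEnd Φ hη⟩))
      ((poincarePairingGRat Φ e).compl₂ (rationalEndRestrict Φ
        ⟨(hasLefschetzProperty_lefschetzG hη).lefschetzInvolution isZGrading_countingG, hNS.lefschetzInvolution_mem_rationalEnd Φ hη⟩))
      (rationalEndRestrict Φ ⟨lefschetzG η, lefschetzG_mem_rationalEnd Φ (hNS.ofRealForm_mem_rationalForms Φ)⟩)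
      (rationalEndRestrict Φ (⟨(hasLefschetzProperty_lefschetzG hη).lefschetzInvolution isZGrading_countingG, hNS.lefschetzInvolution_mem_rationalEnd Φ hη⟩ *
        ⟨lefschetzG η, lefschetzG_mem_rationalEnd Φ (hNS.ofRealForm_mem_rationalForms Φ)⟩ *
        ⟨(hasLefschetzProperty_lefschetzG hη).lefschetzInvolution isZGrading_countingG, hNS.lefschetzInvolution_mem_rationalEnd Φ hη⟩)) :=
  (isAdjointPair_poincarePairingGRat_compl₂_iff Φ e).2 (isAdjointPair_compl₂_lefschetzInvolution_lefschetzG_conj Φ hη e)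

end Transposition

/-! ## §3 `(−1)ᵏ`-symmetry and non-degeneracy over `ℚ` -/

section Symmetry

omit [Nontrivial E] in
/-- **`K_H^ℚ(w, x) = (−1)ᵏ K_H^ℚ(x, w)` for `x ∈ Hᵏ(X; ℚ)`.** [cite: Andre1996Motifs, Prop. 1.2 (p. 11)] [cite: Kleiman1968AlgebraicCycles, §1.4 and §3] -/
theorem IsNSForm.poincarePairingGRat_compl₂_andreHodgeInvolution_apply_of_comm [Nontrivial E] (hNS : IsNSForm Φ η) (hη : ∀ v : E, v ≠ 0 → ∃ w : E, η ![v, w] ≠ 0)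
    (e : Fin N ≃ ι) {k : ℕ} {x : E [⋀^Fin k]→L[ℝ] ℂ} (hx : x ∈ rationalForms Φ k) (w : rationalFormsG Φ) :
    (poincarePairingGRat Φ e).compl₂ (rationalEndRestrict Φ
        ⟨(hasLefschetzProperty_lefschetzG hη).andreHodgeInvolution isZGrading_countingG (finrank ℂ E), hNS.andreHodgeInvolution_mem_rationalEnd Φ hη⟩) w
        ⟨GForm.of k x, of_mem_rationalFormsG Φ hx⟩ =
      (-1) ^ k * (poincarePairingGRat Φ e).compl₂ (rationalEndRestrict Φ
        ⟨(hasLefschetzProperty_lefschetzG hη).andreHodgeInvolution isZGrading_countingG (finrank ℂ E), hNS.andreHodgeInvolution_mem_rationalEnd Φ hη⟩)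
        ⟨GForm.of k x, of_mem_rationalFormsG Φ hx⟩ w := by
  apply Rat.cast_injective (α := ℂ)
  rw [hNS.coe_poincarePairingGRat_compl₂_andreHodgeInvolution Φ hη e, Rat.cast_mul, Rat.cast_pow, Rat.cast_neg, Rat.cast_one,
    hNS.coe_poincarePairingGRat_compl₂_andreHodgeInvolution Φ hη e]
  exact compl₂_andreHodgeInvolution_apply_of_comm Φ hη e (finrank ℂ E) x w

omit [Nontrivial E] in
/-- **`K_∗^ℚ(w, x) = (−1)ᵏ K_∗^ℚ(x, w)` for `x ∈ Hᵏ(X; ℚ)`.** [cite: Kleiman1968AlgebraicCycles, §1.4 and §3] [cite: Milne1999LefschetzClasses, §5 p. 664] -/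
theorem IsNSForm.poincarePairingGRat_compl₂_hodgeInvolution_apply_of_comm [Nontrivial E] (hNS : IsNSForm Φ η) (hη : ∀ v : E, v ≠ 0 → ∃ w : E, η ![v, w] ≠ 0)
    (e : Fin N ≃ ι) {k : ℕ} {x : E [⋀^Fin k]→L[ℝ] ℂ} (hx : x ∈ rationalForms Φ k) (w : rationalFormsG Φ) :
    (poincarePairingGRat Φ e).compl₂ (rationalEndRestrict Φ
        ⟨(hasLefschetzProperty_lefschetzG hη).hodgeInvolution isZGrading_countingG (finrank ℂ E), hNS.hodgeInvolution_mem_rationalEnd Φ hη⟩) w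
        ⟨GForm.of k x, of_mem_rationalFormsG Φ hx⟩ =
      (-1) ^ k * (poincarePairingGRat Φ e).compl₂ (rationalEndRestrict Φ
        ⟨(hasLefschetzProperty_lefschetzG hη).hodgeInvolution isZGrading_countingG (finrank ℂ E), hNS.hodgeInvolution_mem_rationalEnd Φ hη⟩)
        ⟨GForm.of k x, of_mem_rationalFormsG Φ hx⟩ w := by
  apply Rat.cast_injective (α := ℂ)
  rw [hNS.coe_poincarePairingGRat_compl₂_hodgeInvolution Φ hη e, Rat.cast_mul, Rat.cast_pow, Rat.cast_neg, Rat.cast_one,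
    hNS.coe_poincarePairingGRat_compl₂_hodgeInvolution Φ hη e]
  exact compl₂_hodgeInvolution_apply_of_comm Φ hη e (finrank ℂ E) x w

/-- **ANDRÉ'S `ℚ`-FORM `K_H^ℚ` ON `H•(X; ℚ)` IS NON-DEGENERATE** (`B_ℚ` is, row g51-#4, and `*_H|` is an involution of `H•(X; ℚ)`).
[cite: Andre1996Motifs, Prop. 1.2 (p. 11)] [cite: Lange2023AbelianVarietiesComplex, §6.2.4 (p. 310)] -/
theorem IsNSForm.poincarePairingGRat_compl₂_andreHodgeInvolution_nondegenerate (hNS : IsNSForm Φ η) (hη : ∀ v : E, v ≠ 0 → ∃ w : E, η ![v, w] ≠ 0)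
    (e : Fin N ≃ ι) :
    ((poincarePairingGRat Φ e).compl₂ (rationalEndRestrict Φ
        ⟨(hasLefschetzProperty_lefschetzG hη).andreHodgeInvolution isZGrading_countingG (finrank ℂ E), hNS.andreHodgeInvolution_mem_rationalEnd Φ hη⟩)).Nondegenerate := by
  set s := rationalEndRestrict Φ
    ⟨(hasLefschetzProperty_lefschetzG hη).andreHodgeInvolution isZGrading_countingG (finrank ℂ E), hNS.andreHodgeInvolution_mem_rationalEnd Φ hη⟩ with hs
  have hss : ∀ w, s (s w) = w := fun w ↦ Subtype.ext (by
    rw [hs, coe_rationalEndRestrict_apply, coe_rationalEndRestrict_apply]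
    exact (hasLefschetzProperty_lefschetzG hη).andreHodgeInvolution_andreHodgeInvolution isZGrading_countingG _ _)
  obtain ⟨hl, hr⟩ := poincarePairingGRat_nondegenerate Φ e
  refine ⟨fun w hw ↦ hl w fun w' ↦ ?_, fun w' hw ↦ ?_⟩
  · have h1 := hw (s w')
    rwa [LinearMap.compl₂_apply, hss] at h1
  · have h1 : s w' = 0 := hr _ fun w ↦ by
      have h2 := hw w
      rwa [LinearMap.compl₂_apply] at h2
    rw [← hss w', h1, map_zero]

/-- **KLEIMAN'S `ℚ`-FORM `K_∗^ℚ` ON `H•(X; ℚ)` IS NON-DEGENERATE.** [cite: Kleiman1968AlgebraicCycles, §1.4] [cite: Milne1999LefschetzClasses, §5 p. 664]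
[cite: Lange2023AbelianVarietiesComplex, §6.2.4 (p. 310)] -/
theorem IsNSForm.poincarePairingGRat_compl₂_hodgeInvolution_nondegenerate (hNS : IsNSForm Φ η) (hη : ∀ v : E, v ≠ 0 → ∃ w : E, η ![v, w] ≠ 0) (e : Fin N ≃ ι) :
    ((poincarePairingGRat Φ e).compl₂ (rationalEndRestrict Φ
        ⟨(hasLefschetzProperty_lefschetzG hη).hodgeInvolution isZGrading_countingG (finrank ℂ E), hNS.hodgeInvolution_mem_rationalEnd Φ hη⟩)).Nondegenerate := by
  set s := rationalEndRestrict Φ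
    ⟨(hasLefschetzProperty_lefschetzG hη).hodgeInvolution isZGrading_countingG (finrank ℂ E), hNS.hodgeInvolution_mem_rationalEnd Φ hη⟩ with hs
  have hss : ∀ w, s (s w) = w := fun w ↦ Subtype.ext (by
    rw [hs, coe_rationalEndRestrict_apply, coe_rationalEndRestrict_apply]
    exact (hasLefschetzProperty_lefschetzG hη).hodgeInvolution_hodgeInvolution isZGrading_countingG _ _)
  obtain ⟨hl, hr⟩ := poincarePairingGRat_nondegenerate Φ e
  refine ⟨fun w hw ↦ hl w fun w' ↦ ?_, fun w' hw ↦ ?_⟩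
  · have h1 := hw (s w')
    rwa [LinearMap.compl₂_apply, hss] at h1
  · have h1 : s w' = 0 := hr _ fun w ↦ by
      have h2 := hw w
      rwa [LinearMap.compl₂_apply] at h2
    rw [← hss w', h1, map_zero]

end Symmetry

/-! ## §4 On the Hodge classes of a polarized torus: positive-definite RATIONAL quadratic forms -/

section HodgeClasses

/-- **`0 < sign_X(e) · (−1)^g · K_H^ℚ(x, x)` IN `ℚ` for every non-zero Hodge class `x ∈ Hdgᵖ(X)` of a polarized complex torus** (`η` a Riemann form, `e : Fin (2g) ≃ ι`): André's form,
with its orientation sign, is a POSITIVE-DEFINITE RATIONAL QUADRATIC FORM on the `ℚ`-space of Hodge classes (row g51-#5's real-`(p,p)` positivity, rational classes being real,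
and §1). [cite: Andre1996Motifs, §1.1 Remarque (p. 11)] [cite: Kleiman1968AlgebraicCycles, §3] [cite: Lange2023AbelianVarietiesComplex, §7.2.2] -/
theorem IsRiemannForm.orientationSign_mul_poincarePairingGRat_compl₂_andreHodgeInvolution_self_pos (hR : IsRiemannForm Φ η) {g : ℕ} (e : Fin (2 * g) ≃ ι)
    {p : ℕ} {x : E [⋀^Fin (2 * p)]→L[ℝ] ℂ} (hx : x ∈ hodgeClasses Φ p) (hx0 : x ≠ 0) :
    0 < orientationSign Φ e * (-1 : ℚ) ^ g *
      (poincarePairingGRat Φ e).compl₂ (rationalEndRestrict Φ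
        ⟨(hasLefschetzProperty_lefschetzG (hR.exists_apply_ne_zero Φ)).andreHodgeInvolution isZGrading_countingG (finrank ℂ E),
          (hR.isNSForm Φ).andreHodgeInvolution_mem_rationalEnd Φ (hR.exists_apply_ne_zero Φ)⟩)
        ⟨GForm.of (2 * p) x, of_mem_rationalFormsG Φ hx.1⟩ ⟨GForm.of (2 * p) x, of_mem_rationalFormsG Φ hx.1⟩ := by
  have hg : finrank ℂ E = g := finrank_eq_of_finTwoMulEquiv Φ e
  obtain ⟨q, hq, hqx⟩ := hR.exists_pos_rat_orientationSign_mul_compl₂_andreHodgeInvolution_of_mem_hodgeClasses Φ e hx hx0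
  subst hg
  have h1 : orientationSign Φ e * (-1 : ℚ) ^ finrank ℂ E *
      (poincarePairingGRat Φ e).compl₂ (rationalEndRestrict Φ
        ⟨(hasLefschetzProperty_lefschetzG (hR.exists_apply_ne_zero Φ)).andreHodgeInvolution isZGrading_countingG (finrank ℂ E),
          (hR.isNSForm Φ).andreHodgeInvolution_mem_rationalEnd Φ (hR.exists_apply_ne_zero Φ)⟩)
        ⟨GForm.of (2 * p) x, of_mem_rationalFormsG Φ hx.1⟩ ⟨GForm.of (2 * p) x, of_mem_rationalFormsG Φ hx.1⟩ = q := by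
    apply Rat.cast_injective (α := ℂ)
    push_cast
    rw [(hR.isNSForm Φ).coe_poincarePairingGRat_compl₂_andreHodgeInvolution Φ (hR.exists_apply_ne_zero Φ) e]
    exact hqx
  rw [h1]
  exact hq

/-- **`0 < sign_X(e) · (−1)^g · K_∗^ℚ(x, x)` IN `ℚ` for every non-zero Hodge class `x ∈ Hdgᵖ(X)`** — Kleiman's `∗`-form too is a positive-definite rational quadratic form on
`Hdgᵖ(X)` up to the sign `sign_X(e)(−1)^g` (row g51-#6). [cite: Kleiman1968AlgebraicCycles, §1.4 and §3] [cite: Andre1996Motifs, §1.1 Remarque (p. 11)]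
[cite: Lange2023AbelianVarietiesComplex, §7.2.2] -/
theorem IsRiemannForm.orientationSign_mul_poincarePairingGRat_compl₂_hodgeInvolution_self_pos (hR : IsRiemannForm Φ η) {g : ℕ} (e : Fin (2 * g) ≃ ι)
    {p : ℕ} {x : E [⋀^Fin (2 * p)]→L[ℝ] ℂ} (hx : x ∈ hodgeClasses Φ p) (hx0 : x ≠ 0) :
    0 < orientationSign Φ e * (-1 : ℚ) ^ g *
      (poincarePairingGRat Φ e).compl₂ (rationalEndRestrict Φ
        ⟨(hasLefschetzProperty_lefschetzG (hR.exists_apply_ne_zero Φ)).hodgeInvolution isZGrading_countingG (finrank ℂ E),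
          (hR.isNSForm Φ).hodgeInvolution_mem_rationalEnd Φ (hR.exists_apply_ne_zero Φ)⟩)
        ⟨GForm.of (2 * p) x, of_mem_rationalFormsG Φ hx.1⟩ ⟨GForm.of (2 * p) x, of_mem_rationalFormsG Φ hx.1⟩ := by
  have hg : finrank ℂ E = g := finrank_eq_of_finTwoMulEquiv Φ e
  obtain ⟨q, hq, hqx⟩ := hR.exists_pos_rat_orientationSign_mul_compl₂_hodgeInvolution_of_mem_hodgeClasses Φ e hx hx0
  subst hg
  have h1 : orientationSign Φ e * (-1 : ℚ) ^ finrank ℂ E *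
      (poincarePairingGRat Φ e).compl₂ (rationalEndRestrict Φ
        ⟨(hasLefschetzProperty_lefschetzG (hR.exists_apply_ne_zero Φ)).hodgeInvolution isZGrading_countingG (finrank ℂ E),
          (hR.isNSForm Φ).hodgeInvolution_mem_rationalEnd Φ (hR.exists_apply_ne_zero Φ)⟩)
        ⟨GForm.of (2 * p) x, of_mem_rationalFormsG Φ hx.1⟩ ⟨GForm.of (2 * p) x, of_mem_rationalFormsG Φ hx.1⟩ = q := by
    apply Rat.cast_injective (α := ℂ)
    push_cast
    rw [(hR.isNSForm Φ).coe_poincarePairingGRat_compl₂_hodgeInvolution Φ (hR.exists_apply_ne_zero Φ) e]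
    exact hqx
  rw [h1]
  exact hq

/-- **`K_H^ℚ(x, x) = 0 ↔ x = 0` for `x ∈ Hdgᵖ(X)`** (polarized torus): André's rational form is ANISOTROPIC on the Hodge classes. [cite: Andre1996Motifs, §1.1 Remarque (p. 11)]
[cite: Kleiman1968AlgebraicCycles, §3] -/
theorem IsRiemannForm.poincarePairingGRat_compl₂_andreHodgeInvolution_self_eq_zero_iff (hR : IsRiemannForm Φ η) {g : ℕ} (e : Fin (2 * g) ≃ ι) {p : ℕ}
    {x : E [⋀^Fin (2 * p)]→L[ℝ] ℂ} (hx : x ∈ hodgeClasses Φ p) :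
    (poincarePairingGRat Φ e).compl₂ (rationalEndRestrict Φ
        ⟨(hasLefschetzProperty_lefschetzG (hR.exists_apply_ne_zero Φ)).andreHodgeInvolution isZGrading_countingG (finrank ℂ E),
          (hR.isNSForm Φ).andreHodgeInvolution_mem_rationalEnd Φ (hR.exists_apply_ne_zero Φ)⟩)
        ⟨GForm.of (2 * p) x, of_mem_rationalFormsG Φ hx.1⟩ ⟨GForm.of (2 * p) x, of_mem_rationalFormsG Φ hx.1⟩ = 0 ↔ x = 0 := by
  refine ⟨fun h0 ↦ by_contra fun hx0 ↦ ?_, fun h ↦ ?_⟩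
  · have h1 := hR.orientationSign_mul_poincarePairingGRat_compl₂_andreHodgeInvolution_self_pos Φ e hx hx0
    rw [h0, mul_zero] at h1
    exact lt_irrefl _ h1
  · apply Rat.cast_injective (α := ℂ)
    rw [(hR.isNSForm Φ).coe_poincarePairingGRat_compl₂_andreHodgeInvolution Φ (hR.exists_apply_ne_zero Φ) e, Rat.cast_zero]
    change (poincarePairingG Φ e).compl₂ _ (GForm.of (2 * p) x) (GForm.of (2 * p) x) = 0
    rw [h, GForm.of_zero, map_zero]

/-- **`K_∗^ℚ(x, x) = 0 ↔ x = 0` for `x ∈ Hdgᵖ(X)`** (polarized torus): Kleiman's rational form is ANISOTROPIC on the Hodge classes. [cite: Kleiman1968AlgebraicCycles, §3]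
[cite: Andre1996Motifs, §1.1 Remarque (p. 11)] -/
theorem IsRiemannForm.poincarePairingGRat_compl₂_hodgeInvolution_self_eq_zero_iff (hR : IsRiemannForm Φ η) {g : ℕ} (e : Fin (2 * g) ≃ ι) {p : ℕ}
    {x : E [⋀^Fin (2 * p)]→L[ℝ] ℂ} (hx : x ∈ hodgeClasses Φ p) :
    (poincarePairingGRat Φ e).compl₂ (rationalEndRestrict Φ
        ⟨(hasLefschetzProperty_lefschetzG (hR.exists_apply_ne_zero Φ)).hodgeInvolution isZGrading_countingG (finrank ℂ E),
          (hR.isNSForm Φ).hodgeInvolution_mem_rationalEnd Φ (hR.exists_apply_ne_zero Φ)⟩)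
        ⟨GForm.of (2 * p) x, of_mem_rationalFormsG Φ hx.1⟩ ⟨GForm.of (2 * p) x, of_mem_rationalFormsG Φ hx.1⟩ = 0 ↔ x = 0 := by
  refine ⟨fun h0 ↦ by_contra fun hx0 ↦ ?_, fun h ↦ ?_⟩
  · have h1 := hR.orientationSign_mul_poincarePairingGRat_compl₂_hodgeInvolution_self_pos Φ e hx hx0
    rw [h0, mul_zero] at h1
    exact lt_irrefl _ h1
  · apply Rat.cast_injective (α := ℂ)
    rw [(hR.isNSForm Φ).coe_poincarePairingGRat_compl₂_hodgeInvolution Φ (hR.exists_apply_ne_zero Φ) e, Rat.cast_zero]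
    change (poincarePairingG Φ e).compl₂ _ (GForm.of (2 * p) x) (GForm.of (2 * p) x) = 0
    rw [h, GForm.of_zero, map_zero]

end HodgeClasses

end ComplexTorus

end Literature.Geometry.Kaehler
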